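import Summits.BirchSwinnertonDyer.BirchSwinnertonDyer.Theses.PAdicOrderV2
import Literature.NumberTheory.EllipticCurves.BSDAnalyticRankTunnellCMProofs

/-!
# Disproof of `PAdicOrderThesisR2` (crux stmt-BirchSwinnertonDyer-0487) — findings

Work file of the crux disprover (refuter, cdisprove mode), cycle 1 (2026-08-16).
Crux X = `Summit.BirchSwinnertonDyer.BirchSwinnertonDyer.Theses.PAdicOrderV2.PAdicOrderThesisR2`:
`∀ E/ℚ (globally minimal W), ∃ good ORDINARY p, ∃ newform f of E,
 ord_T L_p(f, α_p, T) = r_an(E) ∧ ord_T L_p(f, α_p, T) = r_MW(E)`.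

## Verdict of this cycle: NO KILL — X resists every cheap attack. Why:

* X is logically `BSD-rank(gm) ∧ OnePrimeComparison` (`thesis_iff_bsd_and_onePrime` below):
  BSD-rank for globally minimal models (= the summit, via the proved `closes`) AND, for every
  curve, ONE good ordinary prime at which `ord_T L_p = r_an`. Neither conjunct has a
  counterexample in print; Stein–Wuthrich 2013 §§8–9 and the old route's Sage sweep (1047 pairs,
  all 243 rank-2 classes of conductor < 3000) found no pair (E, p) with `ord_T L_p > r_an`, let
  alone a curve failing at EVERY ordinary p. A refutation of X needs a curve with
  `ord_T L_p(E,T) > r_an(E)` (or `≠ r_MW`) at ALL good ordinary primes — nothing known comes close.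
* The definitions are honest where X uses them: `padicLFunction f α` is the MSD/MTT Riemann-sum
  construction, `unitRoot` is Hensel's unit root (PROVED spec `unitRoot_coe_spec` at ordinary p),
  the interpolation at the trivial character is PROVED (`constantCoeff_padicLFunction_unitRoot`),
  and the rank-0 comparison `ord = 0 ↔ r_an = 0` is PROVED (lead, p96594). No junk is reachable
  at an ORDINARY prime, and X only ever evaluates `L_p` at an ordinary prime of its own choosing.
* The only junk regime of the objects is OFF the ordinary locus: at a prime `p ∣ a_p(W)`
  (supersingular, or additive) `unitRoot W p = 0` (no unit root of `X² - a_p X + p`) and the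
  construction collapses: `L_p(f, 0, T) = 0`, `ord = ⊤` (section `JunkRoot`/`NoUnitRoot`).
  This does not touch X (X is `∃ p` AND demands `IsOrdinaryAt`), but it KILLS the natural
  strengthening "at every good prime p ≥ 5" (`padicOrderThesisR2_false_at_every_good_prime`,
  witness `E_1 : y² = x³ - x` at `p = 7`, `a_7 = 0`) and shows the `IsOrdinaryAt` conjunct is
  load-bearing already at the level of DEFINITIONS: no line may move the witness prime of X (or
  of the lead's `stub_UB_pos`) to a supersingular prime without first building `L_p^±`.

## Findings, indexed (all sorry-free unless marked NEAR-MISS)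

* (a) LOAD-BEARING `IsOrdinaryAt`: `unitRoot_eq_zero_of_dvd`, `padicLFunction_zero`,
  `order_padicLFunction_eq_top_of_dvd`, `order_ne_analyticRank_of_dvd`,
  `not_order_le_analyticRank_of_dvd` (the UB inequality of `stub_UB_pos` is unobtainable at any
  `p ∣ a_p`).
* (c) STRENGTHENING REFUTED: `PAdicOrderThesisR2AtEveryGoodPrime` (X with "∃ good ordinary p"
  replaced by "∀ good p ≥ 5") is FALSE: `padicOrderThesisR2_false_at_every_good_prime`.
  Likewise the comparison-only version `ComparisonAtEveryGoodPrime` (crux #2's equality asked at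
  every good p ≥ 5, ∃f-packaged): `comparison_false_at_every_good_prime`.
* (n) NORMAL FORM: `thesis_iff_bsd_and_onePrime` : X ↔ BSDgm ∧ OnePrimeComparison;
  `modularity_of_thesis` : X → (every globally minimal elliptic W has a newform at some level) —
  so X is unprovable in the tree before `ModularForms.exists_isNewformOf` is vendored with proof
  (the lead's `stub_modularity`), independently of all p-adic work.
* (L) LINE `Sketch` (kato-sandwich-one-prime), stub audit — see the `Line Sketch` section:
  `stub_LB_ge2` (2 ≤ r_an ⇒ r_an ≤ r_MW) is the point-construction half of BSD in rank ≥ 2 with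
  NO p-adic content: modulo the PROVED `closes` and Kato it is not easier than the summit's open
  half; `stub_UB_pos` is open already in analytic rank 1 for non-CM E (= ∃ ordinary p with
  h_p(P) ≠ 0, `PAdicHeightBarrierNarrow` (d)); both are believed TRUE — no refutation attempted
  beyond degenerate regimes; `stub_kato` correctly excludes p = 2; `stub_modularity` is BCDT.
  Joint sufficiency is genuinely proved (`padicOrderThesisR2_of_sandwich`, p96594) — no gap
  smuggled in the composition; the gap is that LB carries the whole difficulty of BSD.

## Census (kit compute, this seat; route kill criterion (a) in analytic rank 3)

Job j016970 (PARI 2.15 `ellpadicL(E,p,n,0,k)`, Taylor data `D_k = ∫ log_p^k dμ_E`, `k = 0..r+1`,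
`ord_T L_p = min{k : D_k ≠ 0}`; script `rank3census.gp` in the seat folder):
* 389a1 (r = 2), calibration: p = 3 (anomalous, a_3 = -2): D = [O(3^7), O(3^6), v=2, v=4] ⇒
  ord_T = 2; p = 5: [O, O, v=2, v=3] ⇒ 2; p = 7: [O, O, v=2, v=3] ⇒ 2 (matches census j015222).
* 5077a1 (r_an = r_MW = 3; N = 5077 prime; p = 3 supersingular, skipped): p = 5 (anomalous,
  a_5 = -4 ≡ 1): D = [O(5^7), O(5^6), O(5^6), v=3, v=4] ⇒ **ord_T L_5(E,T) = 3 = rank**, with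
  `v_5(D_3) = 3` minimal (E-regular at 5). So the ONE-PRIME p-adic conjunct of X holds numerically
  for the rank-3 curve at its smallest ordinary prime; X cannot be killed on 5077a1 by criterion
  (a). Follow-up j017063 (n = 5, 16 GB): p = 7: D = [O, O, O, v=3, O(7^5)] ⇒ ord_T = 3;
  p = 11: [O, O, O, v=3, v=4] ⇒ 3; p = 13: [O, O, O, v=3, v=4] ⇒ 3; p = 17, 19, 23: PARI stack
  > 14 GB (e_STACK rows — resource failures, NOT anomalies). Summary for 5077a1:
  **ord_T L_p(E,T) = 3 = r_an = r_MW at EVERY ordinary prime p ≤ 13** (p = 5, 7, 11, 13), each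
  with `v_p(D_3) = 3` minimal (E-regular) — consistent with X, with cruxes #2/#3, and with
  T-semisimplicity / Ш[p^∞]-finiteness at those primes (modulo IMC).
Together with the ideator's censuses (j015222: 163 curves of rank 1–2, 1311 ordinary pairs,
0 anomalies; j015855: rank ≥ 2, N ≤ 1500, p ≤ 23) no pair (E, p) with `ord_T L_p ≠ rank` is known
in ranks 0–3.

Nothing here asserts a Theses decl positively. Landed copy of (a), (a'), (c):
`Theorems/PAdicOrderThesisR2/Negative/AtEveryGoodPrimeFalse.lean` = proposal p98081, ACCEPTED
(commit 2dd0c69042b7), namespace `…Theorems.PAdicOrderThesisR2.Negative` (importable by lines).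
-/

-- single-conjunct summit: `Summit.BirchSwinnertonDyer.BirchSwinnertonDyer.…` repeats the name by design
set_option linter.dupNamespace false

namespace Summit.BirchSwinnertonDyer.BirchSwinnertonDyer.Cruxes.PAdicOrderThesisR2.Disproof

open Literature.NumberTheory.EllipticCurves Literature.NumberTheory.EllipticCurves.ModularForms
open Summit.BirchSwinnertonDyer.BirchSwinnertonDyer.Theses.PAdicOrderV2
open scoped MatrixGroups ModularForm
open CongruenceSubgroup Filter Topology

/-! ## (a) The junk regime of the Mazur–Swinnerton-Dyer construction: the root `α = 0` -/

section JunkRoot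

variable {N : ℕ} (f : CuspForm (Gamma0 N) 2) {p : ℕ} [Fact p.Prime]

/-- At the junk root `α = 0` every value of the MSD measure at positive level vanishes
(`0⁻¹ = 0`, so `α⁻ⁿ = 0` for `n ≥ 1`). -/
theorem msdMeasure_zero_of_pos {m : ℕ} (hm : 0 < m) (a : ZMod (p ^ m)) :
    msdMeasure f (0 : ℚ_[p]) m a = 0 := by
  obtain ⟨m, rfl⟩ := Nat.exists_eq_add_one_of_ne_zero hm.ne'
  simp [msdMeasure]

omit [Fact p.Prime] in
/-- `e₀ ≥ 1`. -/
theorem cyclotomicExponent_pos : 0 < cyclotomicExponent p := by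
  unfold cyclotomicExponent
  split <;> omega

/-- At `α = 0` every Riemann sum of every coefficient of `L_p(f, α, T)` is `0`. -/
theorem padicLRiemannSum_zero (k n : ℕ) : padicLRiemannSum f (0 : ℚ_[p]) k n = 0 := by
  unfold padicLRiemannSum
  simp only [msdMeasure_zero_of_pos f (Nat.add_pos_right n cyclotomicExponent_pos), zero_mul,
    Finset.sum_const_zero, finsum_zero]

/-- At `α = 0` every coefficient of `L_p(f, α, T)` is `0` (limit of the zero sequence). -/
theorem padicLCoeff_zero (k : ℕ) : padicLCoeff f (0 : ℚ_[p]) k = 0 := by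
  unfold padicLCoeff
  have h : padicLRiemannSum f (0 : ℚ_[p]) k = fun _ => 0 := funext (padicLRiemannSum_zero f k)
  rw [h]
  exact tendsto_const_nhds.limUnder_eq

/-- **`L_p(f, 0, T) = 0`**: at the junk root the tree's `p`-adic `L`-function is the zero power
series (for every cusp form `f`, every prime `p`). -/
theorem padicLFunction_zero : padicLFunction f (0 : ℚ_[p]) = 0 := by
  ext k
  simp [padicLCoeff_zero]

end JunkRoot

/-! ## (a') No unit root when `p ∣ a_p`: `unitRoot W p = 0` there -/

section NoUnitRoot

variable (W : WeierstrassCurve ℚ) [W.IsGloballyMinimal] (p : ℕ) [Fact p.Prime]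

/-- If `p ∣ a_p(W)` then no root of `X² - a_p X + p` in `ℤ_p` is a unit (reduce mod `p`:
`ᾱ² = 0`). Covers every supersingular prime `p ≥ 5` (`a_p = 0`) and additive primes. -/
theorem not_isUnit_root_of_dvd (h : (p : ℤ) ∣ W.frobeniusTrace p) {α : ℤ_[p]}
    (hα : α ^ 2 - (W.frobeniusTrace p : ℤ_[p]) * α + p = 0) : ¬ IsUnit α := by
  intro hu
  have hap : PadicInt.toZMod (W.frobeniusTrace p : ℤ_[p]) = 0 := by
    rw [map_intCast, ZMod.intCast_zmod_eq_zero_iff_dvd]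
    exact h
  have hp0 : PadicInt.toZMod (p : ℤ_[p]) = 0 := by
    rw [map_natCast, ZMod.natCast_self]
  have h2 := congrArg (PadicInt.toZMod (p := p)) hα
  rw [map_add, map_sub, map_mul, map_pow, hap, hp0, zero_mul, sub_zero, add_zero, map_zero] at h2
  exact (hu.map PadicInt.toZMod).ne_zero ((pow_eq_zero_iff two_ne_zero).mp h2)

/-- **`unitRoot W p = 0` whenever `p ∣ a_p(W)`** (the `dif_neg` branch of the definition: there is
no, let alone a unique, unit root). In particular at every supersingular prime. -/
theorem unitRoot_eq_zero_of_dvd (h : (p : ℤ) ∣ W.frobeniusTrace p) : unitRoot W p = 0 := by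
  classical
  unfold unitRoot
  rw [dif_neg]
  rintro ⟨α, ⟨hα, hu⟩, -⟩
  exact not_isUnit_root_of_dvd W p h hα hu

/-- Hence `L_p(E, T)` AS DEFINED is the zero series at every prime dividing `a_p`. -/
theorem padicLFunction_unitRoot_eq_zero_of_dvd (h : (p : ℤ) ∣ W.frobeniusTrace p) {N : ℕ}
    (f : CuspForm (Gamma0 N) 2) : padicLFunction f (unitRoot W p : ℚ_[p]) = 0 := by
  rw [unitRoot_eq_zero_of_dvd W p h, PadicInt.coe_zero, padicLFunction_zero]

/-- … and its `T`-order is `⊤`. -/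
theorem order_padicLFunction_eq_top_of_dvd (h : (p : ℤ) ∣ W.frobeniusTrace p) {N : ℕ}
    (f : CuspForm (Gamma0 N) 2) : (padicLFunction f (unitRoot W p : ℚ_[p])).order = ⊤ := by
  rw [padicLFunction_unitRoot_eq_zero_of_dvd W p h f, PowerSeries.order_zero]

/-- … so it equals NO natural number: the equality `ord = r_an` of X is unobtainable at `p ∣ a_p`. -/
theorem order_ne_analyticRank_of_dvd [W.IsElliptic] (h : (p : ℤ) ∣ W.frobeniusTrace p) {N : ℕ}
    (f : CuspForm (Gamma0 N) 2) :
    (padicLFunction f (unitRoot W p : ℚ_[p])).order ≠ W.analyticRank := by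
  rw [order_padicLFunction_eq_top_of_dvd W p h f]
  exact ENat.top_ne_coe _

/-- … nor `ord = r_MW`. -/
theorem order_ne_mordellWeilRank_of_dvd [W.IsElliptic] (h : (p : ℤ) ∣ W.frobeniusTrace p)
    {N : ℕ} (f : CuspForm (Gamma0 N) 2) :
    (padicLFunction f (unitRoot W p : ℚ_[p])).order ≠ W.mordellWeilRank := by
  rw [order_padicLFunction_eq_top_of_dvd W p h f]
  exact ENat.top_ne_coe _

/-- … nor the UPPER BOUND `ord ≤ r_an` of the lead's `stub_UB_pos` (line `Sketch`): the witness
prime of `OnePrimeUB` can never be a prime dividing `a_p`, for reasons of definition alone. -/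
theorem not_order_le_analyticRank_of_dvd [W.IsElliptic] (h : (p : ℤ) ∣ W.frobeniusTrace p)
    {N : ℕ} (f : CuspForm (Gamma0 N) 2) :
    ¬ (padicLFunction f (unitRoot W p : ℚ_[p])).order ≤ (W.analyticRank : ℕ∞) := by
  rw [order_padicLFunction_eq_top_of_dvd W p h f, top_le_iff]
  exact ENat.coe_ne_top _

/-- Conversely the Kato-side LOWER bound `r_MW ≤ ord` is vacuously true there (`ord = ⊤`): the
Kato inequality carries no information at a prime dividing `a_p`. -/
theorem mordellWeilRank_le_order_of_dvd [W.IsElliptic] (h : (p : ℤ) ∣ W.frobeniusTrace p)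
    {N : ℕ} (f : CuspForm (Gamma0 N) 2) :
    (W.mordellWeilRank : ℕ∞) ≤ (padicLFunction f (unitRoot W p : ℚ_[p])).order := by
  rw [order_padicLFunction_eq_top_of_dvd W p h f]
  exact le_top

end NoUnitRoot

/-! ## (c) The witness `E_1 : y² = x³ - x` at `p = 7` and the refuted strengthenings -/

section Witness

/-- `E_1` is an elliptic curve. -/
instance isElliptic_E1 : (congruentNumberCurve 1).IsElliptic :=
  isElliptic_congruentNumberCurve one_ne_zero

/-- `y² = x³ - x` is a global minimal model (tree theorem for squarefree `n`). -/
instance isGloballyMinimal_E1 : (congruentNumberCurve 1).IsGloballyMinimal :=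
  isGloballyMinimal_congruentNumberCurve squarefree_one

instance fact_prime_seven : Fact (Nat.Prime 7) := ⟨by norm_num⟩

/-- `a_7(E_1) = 0` (`7 ≡ 3 mod 4`: Ireland–Rosen Ch. 18 Thm 5, tree theorem), so `7 ∣ a_7`. -/
theorem seven_dvd_frobeniusTrace_E1 : ((7 : ℕ) : ℤ) ∣ (congruentNumberCurve 1).frobeniusTrace 7 := by
  rw [frobeniusTrace_congruentNumberCurve 1 7,
    frobeniusTrace_congruentNumberCurveInt (by norm_num) (by norm_num) (by norm_num)]
  exact dvd_zero _

/-- `E_1` has good reduction at `7`. -/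
theorem hasGoodReductionAtPrime_E1_seven : (congruentNumberCurve 1).HasGoodReductionAtPrime 7 :=
  hasGoodReductionAtPrime_congruentNumberCurve (by norm_num)

/-- `7` is NOT ordinary for `E_1` (it is a good supersingular prime). -/
theorem not_isOrdinaryAt_E1_seven : ¬ IsOrdinaryAt (congruentNumberCurve 1) 7 :=
  fun h => h.2 seven_dvd_frobeniusTrace_E1

/-- STRENGTHENING of X: the two Mazur–Tate–Teitelbaum equalities asked at EVERY good prime
`p ≥ 5` (instead of at SOME good ordinary prime), `∃f`-packaged exactly as X. -/
def PAdicOrderThesisR2AtEveryGoodPrime : Prop :=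
  ∀ (W : WeierstrassCurve ℚ) [W.IsElliptic] [W.IsGloballyMinimal] (p : ℕ) [Fact p.Prime],
    5 ≤ p → W.HasGoodReductionAtPrime p →
      ∃ (N : ℕ) (_ : NeZero N) (f : CuspForm (Gamma0 N) 2), IsNewformOf W f ∧
        (padicLFunction f (unitRoot W p : ℚ_[p])).order = W.analyticRank ∧
        (padicLFunction f (unitRoot W p : ℚ_[p])).order = W.mordellWeilRank

/-- **Refuted strengthening.** X cannot be asked at every good prime `p ≥ 5`: at the good
supersingular prime `7` of `E_1 : y² = x³ - x` the unit-root `p`-adic `L`-function of the tree is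
the zero series, whose order `⊤` is no analytic rank. (No modularity needed: the `∃ f` is never
reached.) -/
theorem padicOrderThesisR2_false_at_every_good_prime : ¬ PAdicOrderThesisR2AtEveryGoodPrime := by
  intro h
  obtain ⟨N, _, f, -, han, -⟩ :=
    h (congruentNumberCurve 1) 7 (by norm_num) hasGoodReductionAtPrime_E1_seven
  exact order_ne_analyticRank_of_dvd _ 7 seven_dvd_frobeniusTrace_E1 f han

/-- STRENGTHENING of the comparison alone (crux #2's equality) asked at every good `p ≥ 5`,
`∃f`-packaged. -/
def ComparisonAtEveryGoodPrime : Prop :=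
  ∀ (W : WeierstrassCurve ℚ) [W.IsElliptic] [W.IsGloballyMinimal] (p : ℕ) [Fact p.Prime],
    5 ≤ p → W.HasGoodReductionAtPrime p →
      ∃ (N : ℕ) (_ : NeZero N) (f : CuspForm (Gamma0 N) 2), IsNewformOf W f ∧
        (padicLFunction f (unitRoot W p : ℚ_[p])).order = W.analyticRank

/-- **Refuted strengthening** (comparison form): same witness. -/
theorem comparison_false_at_every_good_prime : ¬ ComparisonAtEveryGoodPrime := by
  intro h
  obtain ⟨N, _, f, -, han⟩ :=
    h (congruentNumberCurve 1) 7 (by norm_num) hasGoodReductionAtPrime_E1_seven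
  exact order_ne_analyticRank_of_dvd _ 7 seven_dvd_frobeniusTrace_E1 f han

/-- STRENGTHENING of the lead's `stub_UB_pos` witness clause: "some good prime `p ≥ 5` (ordinary
or not) carries the upper bound `ord ≤ r_an` for some newform", asked of EVERY good `p ≥ 5`. -/
def UBAtEveryGoodPrime : Prop :=
  ∀ (W : WeierstrassCurve ℚ) [W.IsElliptic] [W.IsGloballyMinimal] (p : ℕ) [Fact p.Prime],
    5 ≤ p → W.HasGoodReductionAtPrime p →
      ∃ (N : ℕ) (_ : NeZero N) (f : CuspForm (Gamma0 N) 2), IsNewformOf W f ∧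
        (padicLFunction f (unitRoot W p : ℚ_[p])).order ≤ (W.analyticRank : ℕ∞)

/-- **Refuted strengthening** (upper-bound form): same witness. -/
theorem ub_false_at_every_good_prime : ¬ UBAtEveryGoodPrime := by
  intro h
  obtain ⟨N, _, f, -, han⟩ :=
    h (congruentNumberCurve 1) 7 (by norm_num) hasGoodReductionAtPrime_E1_seven
  exact not_order_le_analyticRank_of_dvd _ 7 seven_dvd_frobeniusTrace_E1 f han

end Witness

/-! ## (n) Normal form of X and what any proof of X must contain -/

section NormalForm

/-- BSD-rank for globally minimal models (equivalent to the summit by the proved `closes` /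
`hasGlobalMinimalModel_rat_holds`, but stated here without that transport). -/
def BSDgm : Prop :=
  ∀ (W : WeierstrassCurve ℚ) [W.IsElliptic] [W.IsGloballyMinimal], W.analyticRank = W.mordellWeilRank

/-- ONE-PRIME COMPARISON: every curve has a good ordinary prime and a newform with
`ord_T L_p = r_an` (the `∃p`-weakening of crux #2 `PAdicOrderComparisonR2`, `∃f`-packaged). -/
def OnePrimeComparison : Prop :=
  ∀ (W : WeierstrassCurve ℚ) [W.IsElliptic] [W.IsGloballyMinimal],
    ∃ (p : ℕ) (_ : Fact p.Prime), IsOrdinaryAt W p ∧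
      ∃ (N : ℕ) (_ : NeZero N) (f : CuspForm (Gamma0 N) 2), IsNewformOf W f ∧
        (padicLFunction f (unitRoot W p : ℚ_[p])).order = W.analyticRank

/-- **X ↔ BSDgm ∧ OnePrimeComparison** (pure logic; `Nat.cast` injective into `ℕ∞`). So a
refutation of X is a refutation of BSD-rank OR a curve with `ord_T L_p ≠ r_an` at EVERY good
ordinary prime — neither exists in print. -/
theorem thesis_iff_bsd_and_onePrime : PAdicOrderThesisR2 ↔ BSDgm ∧ OnePrimeComparison := by
  constructor
  · intro hX
    refine ⟨fun W _ _ => ?_, fun W _ _ => ?_⟩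
    · obtain ⟨p, hp, -, N, hN, f, -, han, hmw⟩ := hX W
      exact_mod_cast han.symm.trans hmw
    · obtain ⟨p, hp, hord, N, hN, f, hf, han, -⟩ := hX W
      exact ⟨p, hp, hord, N, hN, f, hf, han⟩
  · rintro ⟨hB, hC⟩ W _ _
    obtain ⟨p, hp, hord, N, hN, f, hf, han⟩ := hC W
    refine ⟨p, hp, hord, N, hN, f, hf, han, ?_⟩
    rw [han]
    exact_mod_cast hB W

/-- **X proves modularity** (for globally minimal elliptic `W`, at some level): any proof of X
contains a proof of (this form of) `ModularForms.exists_isNewformOf`, which the tree only CITES.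
Hence X is not closable in the tree before modularity is vendored with proof — independently of
all `p`-adic input (the lead's `stub_modularity`). -/
theorem modularity_of_thesis (hX : PAdicOrderThesisR2) :
    ∀ (W : WeierstrassCurve ℚ) [W.IsElliptic] [W.IsGloballyMinimal],
      ∃ (N : ℕ) (_ : NeZero N) (f : CuspForm (Gamma0 N) 2), IsNewformOf W f := by
  intro W _ _
  obtain ⟨-, -, -, N, hN, f, hf, -, -⟩ := hX W
  exact ⟨N, hN, f, hf⟩

/-- **The witness prime of X is never a prime dividing `a_p`** (restating (a') inside X): if X
holds, its prime satisfies `¬ p ∣ a_p` — of course (X demands `IsOrdinaryAt`), but ALSO forced by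
the equality `ord = r_an` alone. Recorded to make the point that dropping `IsOrdinaryAt` from X's
conclusion changes nothing provable: the equalities re-impose `p ∤ a_p`. -/
theorem not_dvd_of_order_eq_analyticRank (W : WeierstrassCurve ℚ) [W.IsElliptic]
    [W.IsGloballyMinimal] (p : ℕ) [Fact p.Prime] {N : ℕ} (f : CuspForm (Gamma0 N) 2)
    (h : (padicLFunction f (unitRoot W p : ℚ_[p])).order = W.analyticRank) :
    ¬ (p : ℤ) ∣ W.frobeniusTrace p :=
  fun hd => order_ne_analyticRank_of_dvd W p hd f h

end NormalForm

/-! ## Line `Sketch` (kato-sandwich-one-prime) — stub audit (prose; nothing refuted)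

Registered stubs (skeleton f95626e2fd97): `stub_modularity`, `stub_kato` (= `PAdicOrderKatoSideR2`),
`stub_UB_pos`, `stub_LB_rank1`, `stub_LB_ge2`; `stub_UB_rank0` PROVED (p96136/p96594).

* `stub_LB_ge2 : 2 ≤ r_an W → r_an W ≤ r_MW W`. This is the LOWER-BOUND HALF OF BSD in analytic
  rank ≥ 2 (existence of `r_an` independent rational points). It has no `p`-adic content and no
  known approach (Heegner points give one point in rank 1 only: `HeegnerPointsRankOne` barrier).
  Degenerate/small cases: none typable (no curve with certified `r_an ≥ 2` exists in the tree or
  in print with `r_an` computed exactly … `r_an ≤ 3` certifiable numerically only). NOT refutable;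
  believed true; but as a stub it is as hard as the summit's open half — flag for the lead/consult:
  the sandwich trades X for {OnePrimeUB, BSD-lower-bound}, i.e. the line can at best prove
  "X ⟸ BSD-LB ∧ OnePrimeUB ∧ Kato", which is `thesis_iff_bsd_and_onePrime` read right-to-left
  with BSD-UB supplied by Kato+UB. Honest, but the crux of BSD is parked inside `stub_LB_ge2`.
* `stub_LB_rank1 : r_an = 1 → 1 ≤ r_MW`: Gross–Zagier–Kolyvagin; true; conditional proof landed
  (p96175) from the undischarged fact `rank_eq_analyticRank_of_analyticRank_le_one`.
* `stub_UB_pos : 0 < r_an → ∃ p ≥ 5 ordinary, ∀ newform f, ord ≤ r_an`: rank 1 = "∃ ordinary p with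
  h_p(P) ≠ 0" (weak rank-one Schneider at one prime; open for non-CM E per
  `PAdicHeightBarrierNarrow` scope (d); CM: Bertrand 1982); rank ≥ 2: non-vanishing of the
  `r_an`-th Taylor coefficient at one prime — open. Mutation: its `5 ≤ p` can be dropped without
  loss (Kato needs only `p ≠ 2`; `p = 3` ordinary would do) — information for the prover, not a
  defect. Its prime canNOT be supersingular (`ub_false_at_every_good_prime`).
* `stub_kato : PAdicOrderKatoSideR2` (p ≠ 2): Kato 2004 Thm 17.4 (divisibility in Λ ⊗ ℚ_p, no
  image hypothesis needed after ⊗ℚ_p) + Mazur control; true. At p = 2 the statement is not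
  claimed. Vacuous at `p ∣ a_p` (`mordellWeilRank_le_order_of_dvd`) — harmless.
* Joint sufficiency: PROVED by the lead (`padicOrderThesisR2_of_sandwich`); re-derived abstractly
  by `thesis_iff_bsd_and_onePrime`. No smuggled gap in the composition.

## Dead ends of this cycle (one line each)
* junk in `IsNewformOf` (n = 0 coefficient, level N free): consistent (`cuspCoeff f 0 = 0 =
  W.LFunction 0`; level pinned only by a cited fact, irrelevant to X).
* junk in `limUnder`: divergent Riemann sums would make every coefficient the SAME unspecified
  constant (order 0 or ⊤, never r_an ≥ 1) — but divergence at a unit root is false (bounded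
  measure, Manin–Drinfeld) and unprovable either way here; no lemma.
* p = 2, 3 as witness primes: allowed by X, harmless (X is ∃p); Kato's stub needs p ≠ 2 only.
* dropping `[W.IsElliptic]`: singular cubics have no global minimal model instance in the tree to
  instantiate; skipped. Dropping `[W.IsGloballyMinimal]`: does not typecheck (`IsOrdinaryAt`,
  `unitRoot` need it).
-/

end Summit.BirchSwinnertonDyer.BirchSwinnertonDyer.Cruxes.PAdicOrderThesisR2.Disproof
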